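import Summits.NavierStokesRegularity.FunctionalMining.NoGo.StretchingHolderDeficit
import Summits.NavierStokesRegularity.FunctionalMining.StretchingLowerCellularField
import Literature.Analysis.FunctionSpaces.TorusPlanarLift
import Literature.Analysis.FunctionSpaces.TorusEnstrophyOrthogonality
import Literature.Analysis.FunctionSpaces.TorusTestFunction
import Literature.Analysis.FunctionSpaces.TorusFourierCalculus
import HarnessLib

/-!
# Functional mining (K1-Q1, door D2a), part 1 of 2: the planar stream-field mechanism behind the FLOOR of the `L⁴` Calderón–Zygmund door, and the hypothesis shape `SecondRieszQuarticLower`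

Search for candidate a priori estimates; no regularity claim.

Cell `pub-nsfunc`, dict(+lead) seat (gen 10, split into two files by gen 11 for the 400-line cap),
STAGED for a prover-role seat (target tree path
`Summits/NavierStokesRegularity/FunctionalMining/NoGo/StretchingStrainL4FloorField.lean`; part 2 =
`NoGo/StretchingStrainL4Floor.lean`, which imports this file and proves the floor theorems). Static facts
about smooth divergence-free fields on the flat torus `𝕋³` only; nothing is asserted about Navier–Stokes
solutions or their regularity.

THE DOOR (context). The tree theorem `stretchingSupBound_of_strainL4Bound` (`NoGo/StretchingSupNotSharpCore`):
a constant `K ≥ 0` in the quartic strain/vorticity inequality `∫_{𝕋³}|S|_F⁴ ≤ K ∫_{𝕋³}|ω|⁴` for all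
smooth divergence-free fields (`StrainL4Bound K`, `NoGo/StretchingHolderDeficit`) yields the static
stretching bound with the constant `2/√3 − 1/(4√3(4K+1))`. Part 2 bounds `K` from below; this part
supplies the mechanism.

CONTENTS OF THIS PART. (1) The planar operators `Δψ = ∂₀²ψ + ∂₁²ψ` (`lap`), `□ψ = ∂₀²ψ − ∂₁²ψ` (`box`), the
planar strain density `strainSq`, and the HYPOTHESIS SHAPE `SecondRieszQuarticLower a` (for every `c < a⁴`
some smooth `ψ` on `𝕋²` has `∫(Δψ)⁴ > 0` and `c∫(Δψ)⁴ ≤ ∫(□ψ)⁴`) — a `def … : Prop`, displayed and used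
downstream ONLY as a hypothesis, never asserted. IN PRINT at `a = 3` it is the lower bound
`‖R₁² − R₂²‖_{L^p(ℝ²)} ≥ p* − 1` at `p = 4` of Geiss–Montgomery-Smith–Saksman, Trans. Amer. Math. Soc. 362
(2010) 553–575 (arXiv:math/0701516), Corollary 1.1, transferred to mean-zero functions on the torus by their
Lemma 2.2, with the symbol identity `(R₁² − R₂²)Δψ = −(∂₁² − ∂₂²)ψ` and the density of trigonometric
polynomials; a literature seat types it under `Literature/` with its citation tag (no internally-minted
statement enters as a cited fact). (2) MECHANISM (planar stream fields; Majda–Bertozzi 2002 §2.3.1): for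
smooth `ψ` on `𝕋²` the `2½`-dimensional field `u = (−∂₁ψ, ∂₀ψ, 0)(x₀,x₁)` (tree `Torus.twoHalf`; here
`field ψ`) is smooth and divergence free (`∂₀∂₁ = ∂₁∂₀`, tree `Torus.partialDeriv_comm`), with, pointwise
at `y = πx`, `|S|_F² = (∂₀∂₁ψ)² + (∂₁∂₀ψ)² + ½((∂₀² − ∂₁²)ψ)²` (`strainNormSqAt_field`) and `|ω|² = (Δψ)²`
(`torusVorticitySqAt_field`). (3) Integrating over `𝕋³ = 𝕋¹ × 𝕋²` (tree `Torus.integral_comp_planarProj`):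
`StrainL4Bound K → ¼ ∫_{𝕋²} (□ψ)⁴ ≤ K ∫_{𝕋²} (Δψ)⁴` for every smooth `ψ` (`quarter_integral_box_le`), i.e.
`4K ≥ ‖(∂₀² − ∂₁²)Δ⁻¹‖⁴_{L⁴_0(𝕋²) → L⁴(𝕋²)}` in the sense of smooth test functions — UNCONDITIONAL.

References: S. Geiss, S. Montgomery-Smith, E. Saksman, Trans. AMS 362 (2010), Cor. 1.1, Lemma 2.2
(arXiv:math/0701516); F. Nazarov, A. Volberg, Algebra i Analiz 15 (2003) (upper bound);
A. Majda, A. Bertozzi, *Vorticity and Incompressible Flow* (CUP 2002) §2.3.1. Cell documents: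
`HOME/pub-nsfunc-nogo/KSTAR4.md` [ours, UNREVIEWED by a journal], `HOME/pub-nsfunc-dict/K1Q1-LADDER.md` §B,
`HOME/DICTIONARY.md` §14 row D2a, `HOME/dict/K0-FLAGS.json` A8.explicit_deficit.
-/

noncomputable section

open MeasureTheory Set Filter Topology Function
open scoped InnerProductSpace ContDiff

namespace Summit.NavierStokesRegularity.FunctionalMining

open Literature.Analysis Literature.Analysis.FunctionSpaces Literature.Analysis.FunctionSpaces.Torus
open Literature.Analysis.FluidPDE Literature.Analysis.FluidPDE.Torus

namespace StrainL4Floor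

/-! ## 1. Second-order operators on `𝕋²` and the hypothesis -/

/-- The planar Laplacian in iterated partial derivatives: `Δψ(y) = ∂₀∂₀ψ(y) + ∂₁∂₁ψ(y)`. [folklore] -/
def lap (ψ : UnitAddTorus (Fin 2) → ℝ) (y : UnitAddTorus (Fin 2)) : ℝ :=
  Torus.partialDeriv 0 (Torus.partialDeriv 0 ψ) y + Torus.partialDeriv 1 (Torus.partialDeriv 1 ψ) y

/-- The hyperbolic second-order operator `□ψ(y) = ∂₀∂₀ψ(y) − ∂₁∂₁ψ(y)` (`= −(R₀² − R₁²)Δψ`). [folklore] -/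
def box (ψ : UnitAddTorus (Fin 2) → ℝ) (y : UnitAddTorus (Fin 2)) : ℝ :=
  Torus.partialDeriv 0 (Torus.partialDeriv 0 ψ) y - Torus.partialDeriv 1 (Torus.partialDeriv 1 ψ) y

/-- The planar strain density of the stream field of `ψ`:
`|S|_F²(y) = (∂₀∂₁ψ)² + (∂₁∂₀ψ)² + ½(□ψ)²` (see `strainNormSqAt_field`). [folklore] -/
def strainSq (ψ : UnitAddTorus (Fin 2) → ℝ) (y : UnitAddTorus (Fin 2)) : ℝ :=
  Torus.partialDeriv 0 (Torus.partialDeriv 1 ψ) y ^ 2 + Torus.partialDeriv 1 (Torus.partialDeriv 0 ψ) y ^ 2 +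
    box ψ y ^ 2 / 2

/-- **HYPOTHESIS SHAPE (named-fact-shaped; physical-space form on `𝕋²` of a lower bound
`‖(∂₀² − ∂₁²)Δ⁻¹‖_{L⁴_0(𝕋²) → L⁴(𝕋²)} ≥ a`, with the constant `a` displayed).** For every `c < a⁴` there is a
smooth `ψ` on `𝕋²` with `∫(Δψ)⁴ > 0` and `c·∫(Δψ)⁴ ≤ ∫(□ψ)⁴`. IN PRINT exactly at `a = 3`:
Geiss–Montgomery-Smith–Saksman, Trans. AMS 362 (2010), Corollary 1.1 (`‖R₁² − R₂²‖_{L^p(ℝ²)} = p* − 1`,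
`= 3` at `p = 4`; lower bound theirs, upper bound Nazarov–Volberg — so the statement is FALSE for `a > 3`)
with their Lemma 2.2 (transference `ℝⁿ ↔ 𝕋ⁿ` on mean-zero functions for `0`-homogeneous multipliers smooth
off `0`), the symbol identity `(R₁² − R₂²)Δ = −(∂₁² − ∂₂²)` and density of trigonometric polynomials
(every mean-zero trigonometric polynomial is a `Δψ`). `SecondRieszQuarticLower 3` is NOT a tree fact: it
is to be typed under `Literature/` by a literature seat with its citation tag; below it is used ONLY as a
hypothesis. Search for candidate a priori estimates; no regularity claim — nothing is asserted.
[ours — typed question K1-Q1 door D2a; the published input (arXiv:math/0701516, Cor. 1.1 + Lemma 2.2)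
is named, not vendored: a literature seat types it] -/
def SecondRieszQuarticLower (a : ℝ) : Prop :=
  ∀ c : ℝ, c < a ^ 4 → ∃ ψ : UnitAddTorus (Fin 2) → ℝ, Torus.IsSmooth ψ ∧
    0 < ∫ y, lap ψ y ^ 4 ∧ c * ∫ y, lap ψ y ^ 4 ≤ ∫ y, box ψ y ^ 4

/-! ## 2. The planar stream field `u_ψ = (−∂₁ψ, ∂₀ψ, 0) ∘ π` on `𝕋³` -/

/-- The perpendicular gradient `∇⊥ψ = (−∂₁ψ, ∂₀ψ)` on `𝕋²`, written on the standard basis. [folklore] -/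
def sgrad (ψ : UnitAddTorus (Fin 2) → ℝ) (y : UnitAddTorus (Fin 2)) : EuclideanSpace ℝ (Fin 2) :=
  Torus.partialDeriv 1 ψ y • EuclideanSpace.single 0 (-1 : ℝ) +
    Torus.partialDeriv 0 ψ y • EuclideanSpace.single 1 (1 : ℝ)

/-- The `2½`-dimensional stream field `u_ψ(x) = (−∂₁ψ, ∂₀ψ, 0)(x₀, x₁)` on `𝕋³`. [folklore] -/
def field (ψ : UnitAddTorus (Fin 2) → ℝ) : UnitAddTorus (Fin 3) → EuclideanSpace ℝ (Fin 3) :=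
  twoHalf (sgrad ψ) (fun _ => (0 : ℝ))

/-- `y ↦ a(y) • v` is `C¹` for a `C¹` scalar `a` and a constant vector `v`. [folklore] -/
theorem isContDiff_smul_const {a : UnitAddTorus (Fin 2) → ℝ} (ha : Torus.IsContDiff 1 a)
    (v : EuclideanSpace ℝ (Fin 2)) : Torus.IsContDiff 1 (fun y => a y • v) :=
  ContDiff.smul ha (isContDiff_const (d := Fin 2) (n := 1) v)

section Field

variable {ψ : UnitAddTorus (Fin 2) → ℝ} (hψ : Torus.IsSmooth ψ)
include hψ

/-- `∇⊥ψ` is smooth. [folklore] -/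
theorem isSmooth_sgrad : Torus.IsSmooth (sgrad ψ) :=
  ((hψ.partialDeriv 1).smul' (isSmooth_const _)).add ((hψ.partialDeriv 0).smul' (isSmooth_const _))

/-- `C¹` bookkeeping. [folklore] -/
theorem isContDiff_sgrad : Torus.IsContDiff 1 (sgrad ψ) := (isSmooth_sgrad hψ).isContDiff (by simp)

/-- **`u_ψ` is smooth.** [folklore] -/
theorem isSmooth_field : Torus.IsSmooth (field ψ) := (isSmooth_sgrad hψ).twoHalf (isSmooth_const _)

/-- **`∂ⱼ∇⊥ψ = (−∂ⱼ∂₁ψ, ∂ⱼ∂₀ψ)`.** [folklore] -/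
theorem partialDeriv_sgrad (j : Fin 2) (y : UnitAddTorus (Fin 2)) :
    Torus.partialDeriv j (sgrad ψ) y =
      Torus.partialDeriv j (Torus.partialDeriv 1 ψ) y • EuclideanSpace.single 0 (-1 : ℝ) +
        Torus.partialDeriv j (Torus.partialDeriv 0 ψ) y • EuclideanSpace.single 1 (1 : ℝ) := by
  have e : sgrad ψ = (fun y => Torus.partialDeriv 1 ψ y • EuclideanSpace.single (0 : Fin 2) (-1 : ℝ)) +
      fun y => Torus.partialDeriv 0 ψ y • EuclideanSpace.single (1 : Fin 2) (1 : ℝ) := rfl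
  have h1 : Torus.IsContDiff 1 (Torus.partialDeriv 1 ψ) := (hψ.partialDeriv 1).isContDiff (by simp)
  have h0 : Torus.IsContDiff 1 (Torus.partialDeriv 0 ψ) := (hψ.partialDeriv 0).isContDiff (by simp)
  rw [e, partialDeriv_add (isContDiff_smul_const h1 _) (isContDiff_smul_const h0 _), Pi.add_apply,
    partialDeriv_smul h1 (isContDiff_const _), partialDeriv_smul h0 (isContDiff_const _),
    CellularStretching.partialDeriv_const_eq_zero, CellularStretching.partialDeriv_const_eq_zero]
  simp

/-- **`∇⊥ψ` is divergence free**: `∂₀(−∂₁ψ) + ∂₁(∂₀ψ) = 0` by symmetry of second derivatives. [folklore] -/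
theorem isDivFree_sgrad : Torus.IsDivFree (sgrad ψ) := by
  intro y
  rw [divergence_eq_sum_partialDeriv_apply (isContDiff_sgrad hψ), Fin.sum_univ_two,
    partialDeriv_sgrad hψ, partialDeriv_sgrad hψ]
  simp [partialDeriv_comm hψ 0 1 y]

/-- **`u_ψ` is divergence free.** [folklore] -/
theorem isDivFree_field : Torus.IsDivFree (field ψ) := (isDivFree_sgrad hψ).twoHalf _

/-- **`∂₀u_ψ = (−∂₀∂₁ψ, ∂₀∂₀ψ, 0)`** at `y = πx`. [folklore] -/
theorem partialDeriv_zero_field (x : UnitAddTorus (Fin 3)) :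
    Torus.partialDeriv 0 (field ψ) x 0 = -Torus.partialDeriv 0 (Torus.partialDeriv 1 ψ) (planarProj x) ∧
    Torus.partialDeriv 0 (field ψ) x 1 = Torus.partialDeriv 0 (Torus.partialDeriv 0 ψ) (planarProj x) ∧
    Torus.partialDeriv 0 (field ψ) x 2 = 0 := by
  have h := partialDeriv_twoHalf_castSucc (isContDiff_sgrad hψ) (isContDiff_const (0 : ℝ)) 0
  rw [show (Fin.castSucc (0 : Fin 2) : Fin 3) = 0 from rfl] at h
  rw [field, h]
  refine ⟨?_, ?_, ?_⟩
  · rw [show (0 : Fin 3) = Fin.castSucc (0 : Fin 2) from rfl, twoHalf_apply_castSucc, partialDeriv_sgrad hψ]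
    simp
  · rw [show (1 : Fin 3) = Fin.castSucc (1 : Fin 2) from rfl, twoHalf_apply_castSucc, partialDeriv_sgrad hψ]
    simp
  · rw [twoHalf_apply_two, CellularStretching.partialDeriv_const_eq_zero]

/-- **`∂₁u_ψ = (−∂₁∂₁ψ, ∂₁∂₀ψ, 0)`** at `y = πx`. [folklore] -/
theorem partialDeriv_one_field (x : UnitAddTorus (Fin 3)) :
    Torus.partialDeriv 1 (field ψ) x 0 = -Torus.partialDeriv 1 (Torus.partialDeriv 1 ψ) (planarProj x) ∧
    Torus.partialDeriv 1 (field ψ) x 1 = Torus.partialDeriv 1 (Torus.partialDeriv 0 ψ) (planarProj x) ∧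
    Torus.partialDeriv 1 (field ψ) x 2 = 0 := by
  have h := partialDeriv_twoHalf_castSucc (isContDiff_sgrad hψ) (isContDiff_const (0 : ℝ)) 1
  rw [show (Fin.castSucc (1 : Fin 2) : Fin 3) = 1 from rfl] at h
  rw [field, h]
  refine ⟨?_, ?_, ?_⟩
  · rw [show (0 : Fin 3) = Fin.castSucc (0 : Fin 2) from rfl, twoHalf_apply_castSucc, partialDeriv_sgrad hψ]
    simp
  · rw [show (1 : Fin 3) = Fin.castSucc (1 : Fin 2) from rfl, twoHalf_apply_castSucc, partialDeriv_sgrad hψ]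
    simp
  · rw [twoHalf_apply_two, CellularStretching.partialDeriv_const_eq_zero]

omit hψ in
/-- **`∂₂u_ψ = 0`**: the field is `2½`-dimensional. [folklore] -/
theorem partialDeriv_two_field : Torus.partialDeriv 2 (field ψ) = 0 := by
  rw [show (2 : Fin 3) = Fin.last 2 from rfl, field, partialDeriv_twoHalf_last]

/-- **Pointwise strain of the stream field**: `|S(u_ψ)|_F²(x) = (∂₀∂₁ψ)² + (∂₁∂₀ψ)² + ½(□ψ)²` at
`y = πx` (the in-plane `2 × 2` block; all entries touching the third index vanish). [folklore] -/
theorem strainNormSqAt_field (x : UnitAddTorus (Fin 3)) :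
    strainNormSqAt (field ψ) x = strainSq ψ (planarProj x) := by
  obtain ⟨h00, h01, h02⟩ := partialDeriv_zero_field hψ x
  obtain ⟨h10, h11, h12⟩ := partialDeriv_one_field hψ x
  have h2 := partialDeriv_two_field (ψ := ψ)
  unfold strainNormSqAt strainSq box
  simp only [Fin.sum_univ_three, h00, h01, h02, h10, h11, h12, h2, Pi.zero_apply, PiLp.zero_apply]
  ring

/-- **Pointwise vorticity of the stream field**: `|ω(u_ψ)|²(x) = (Δψ)²` at `y = πx`. [folklore] -/
theorem torusVorticitySqAt_field (x : UnitAddTorus (Fin 3)) :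
    torusVorticitySqAt (field ψ) x = lap ψ (planarProj x) ^ 2 := by
  obtain ⟨h00, h01, h02⟩ := partialDeriv_zero_field hψ x
  obtain ⟨h10, h11, h12⟩ := partialDeriv_one_field hψ x
  have h2 := partialDeriv_two_field (ψ := ψ)
  unfold torusVorticitySqAt lap
  simp only [Fin.sum_univ_three, h00, h01, h02, h10, h11, h12, h2, Pi.zero_apply, PiLp.zero_apply]
  ring

/-! ## 3. Integration over `𝕋³ = 𝕋¹ × 𝕋²` and the floor -/

/-- Iterated partial derivatives of a smooth `ψ` are continuous. [folklore] -/
theorem continuous_partialDeriv₂ (i j : Fin 2) :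
    Continuous fun y => Torus.partialDeriv i (Torus.partialDeriv j ψ) y :=
  ((hψ.partialDeriv j).partialDeriv i).continuous

/-- `Δψ` is continuous. [folklore] -/
theorem continuous_lap : Continuous (lap ψ) :=
  (continuous_partialDeriv₂ hψ 0 0).add (continuous_partialDeriv₂ hψ 1 1)

/-- `□ψ` is continuous. [folklore] -/
theorem continuous_box : Continuous (box ψ) :=
  (continuous_partialDeriv₂ hψ 0 0).sub (continuous_partialDeriv₂ hψ 1 1)

/-- The planar strain density is continuous. [folklore] -/
theorem continuous_strainSq : Continuous (strainSq ψ) :=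
  (((continuous_partialDeriv₂ hψ 0 1).pow 2).add ((continuous_partialDeriv₂ hψ 1 0).pow 2)).add
    (((continuous_box hψ).pow 2).div_const 2)

/-- **`∫_{𝕋³} |S(u_ψ)|_F⁴ = ∫_{𝕋²} (|S|_F²)²`** (Fubini over the vertical circle, tree
`Torus.integral_comp_planarProj`). [folklore] -/
theorem integral_strain_four_field :
    ∫ x, strainNormSqAt (field ψ) x ^ 2 = ∫ y, strainSq ψ y ^ 2 := by
  rw [← integral_comp_planarProj (b := fun y => strainSq ψ y ^ 2)
    ((continuous_strainSq hψ).pow 2).aestronglyMeasurable]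
  refine integral_congr_ae (Eventually.of_forall fun x => ?_)
  beta_reduce
  rw [strainNormSqAt_field hψ]

/-- **`∫_{𝕋³} |ω(u_ψ)|⁴ = ∫_{𝕋²} (Δψ)⁴`.** [folklore] -/
theorem integral_vorticity_four_field :
    ∫ x, torusVorticitySqAt (field ψ) x ^ 2 = ∫ y, lap ψ y ^ 4 := by
  rw [← integral_comp_planarProj (b := fun y => lap ψ y ^ 4)
    ((continuous_lap hψ).pow 4).aestronglyMeasurable]
  refine integral_congr_ae (Eventually.of_forall fun x => ?_)
  beta_reduce
  rw [torusVorticitySqAt_field hψ]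
  ring

/-- **UNCONDITIONAL PLANAR CONSEQUENCE of `StrainL4Bound K`**: for every smooth `ψ` on `𝕋²`,
`¼ ∫_{𝕋²} (□ψ)⁴ ≤ K ∫_{𝕋²} (Δψ)⁴` — test the quartic strain/vorticity inequality on the stream field `u_ψ`
and use `|S|_F⁴ ≥ ¼(□ψ)⁴`, `|ω|⁴ = (Δψ)⁴`. Search for candidate a priori estimates; no regularity claim.
[ours — K1-Q1 door D2a, floor mechanism] -/
theorem quarter_integral_box_le {K : ℝ} (hK : StrainL4Bound (d := Fin 3) K) :
    (∫ y, box ψ y ^ 4) / 4 ≤ K * ∫ y, lap ψ y ^ 4 := by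
  have h := hK (Fintype.card_fin 3) (field ψ) (isSmooth_field hψ) (isDivFree_field hψ)
  rw [integral_strain_four_field hψ, integral_vorticity_four_field hψ] at h
  refine le_trans ?_ h
  rw [← integral_div]
  refine integral_mono (((continuous_box hψ).pow 4).div_const 4).integrable_unitAddTorus
    ((continuous_strainSq hψ).pow 2).integrable_unitAddTorus fun y => ?_
  show box ψ y ^ 4 / 4 ≤ strainSq ψ y ^ 2
  have hs : 0 ≤ Torus.partialDeriv 0 (Torus.partialDeriv 1 ψ) y ^ 2 +
      Torus.partialDeriv 1 (Torus.partialDeriv 0 ψ) y ^ 2 := by positivity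
  unfold strainSq
  nlinarith [mul_nonneg hs hs, mul_nonneg hs (sq_nonneg (box ψ y))]

end Field


end StrainL4Floor

end Summit.NavierStokesRegularity.FunctionalMining

end
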